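import Summits.BirchSwinnertonDyer.Rank1Residual.X11b.CastellaErratumThm11Skeleton
import Summits.BirchSwinnertonDyer.Rank1Residual.X2.ClassClosureO9
import Literature.NumberTheory.EllipticCurves.PAdicLFunctionMultiplicativeFunctionalEquationProofs
import Literature.NumberTheory.EllipticCurves.SelmerInftyTorsionFiniteProofs
import HarnessLib

/-!
# Class X2 at a NON-SPLIT Eisenstein prime `p ‖ N`: the typed HIGHER-WEIGHT INPUT ("[CGS] extended to
# higher weight modular forms", Keller–Yin p. 4) and its kernel transfer to Mazur's main conjecture at
# the pair (cell `bsd-eis`, seat `bsd-eis-cgshw`; programme row B11 / A10-non-split, object K2ᴱ)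

HONEST FRAMING (cell `bsd-eis`, run/shared/lean/pub/bsd-eis/; FULL-BSD-RANK1-PROGRAMME §4 verbatim in
spirit): nothing here is a new theorem of number theory. This file TYPES, in the tree's existing
vocabulary, the deliverable that Keller–Yin (arXiv:2402.12781v2, p. 4, after Thm. 4 (imc mult)) name
in one sentence — "We remark that our Main Conjecture would yield a rank 1 BSD formula provided the
results in [CGS] are extended to higher weight modular forms" — and proves, by the commutative algebra
ALREADY kernel-checked for X11b route R1 (`X11b/FittingCongruenceLimit.lean`,
`X11b/CastellaErratumCongruenceLimit.lean`: the congruence limit of [Ski16, p. 192] = erratum p. 4 =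
Keller–Yin §5 Lemma 5.0.3), that this deliverable implies the tree's typed input
`X2.MazurMainConjectureAt W p` at a NON-SPLIT multiplicative Eisenstein prime, hence (existing consumers)
`BSD(E,p)` on X2 ∩ {r_an = 0} ∩ {non-split} (sub-cell X2b's non-split half, no parity hypothesis) and,
modulo the per-pair Schneider certificate, on O9 ∩ {non-split} (`X2/ClassClosureO9.lean`). Every
theorem is CONDITIONAL on the typed input; X2 stays CONSTRUCTION-SHAPED; no label changes.

## What "[CGS] extended to higher weight" has to mean (seat memo `HOME/MEMO-cgshw-K2E.md` §0–§2)

Keller–Yin's rank-one formula at GOOD `p` (proof of Thm. 4.2.1, p. 22) is [CGLS22] (5.7): the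
anticyclotomic IMC + control + Gross–Zagier + BDP give `(p-part of BSD for E, rank 1) = −(p-part of BSD
for E^K, rank 0)`, and the right-hand side "vanishes by [CGLS, Thm. 5.1.4], a result of
Greenberg–Vatsal", the parity restriction of which "is now removed by [CGS]" — i.e. by CGS 2025
**Theorem A** (Mazur's CYCLOTOMIC main conjecture at an Eisenstein prime of good reduction with
`φ|_{G_p} ≠ 1, ω`) applied to `E^K`. At `p ‖ N` the same display needs Mazur's main conjecture for the
rank-`0` partner `E^K` AT A MULTIPLICATIVE Eisenstein prime (`X2.MazurMainConjectureAt`, sub-cell X2b's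
typed input, "nothing in print"), and the printed road to a cyclotomic main conjecture at `p ‖ N` is
Skinner 2016 §3.1 (= Castella's erratum p. 4 = Keller–Yin §5 (a)–(e)): approximate `f_E` `p`-adically by
the GOOD ORDINARY members `g_m` (weight `k_m ≡ 2 (mod p−1)`, `k_m > 2`, level `N/p`, `g_m ≡ f_E mod
p^m`) of the Hida family through `f_E`, prove the main conjecture for each `g_m`, and pass to the limit
in Fitting ideals. The members `g_m` are residually REDUCIBLE with the SAME characters `{φ, ψ}` (KY §5
(c)), so the input needed for them is exactly CGS Theorem A for higher-weight residually reducible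
`p`-ordinary newforms — "the results in [CGS] extended to higher weight modular forms".

LOCAL DICHOTOMY (tree theorems `X2.TateLineDecomposition.not_fix_and_not_quot_of_not_split` /
`fix_or_quot_of_split`, Greenberg–Vatsal §2): at a multiplicative Eisenstein prime the CGS hypothesis
"`φ|_{G_p} ≠ 1, ω`" HOLDS for every rational line iff `p` is NON-SPLIT, and FAILS for every stable line
iff `p` is SPLIT. Since `{φ, ψ}|_{G_p}` is an invariant of `E[p]`, shared by every member of the Hida
family, the higher-weight Theorem A AS PRINTED can only serve NON-SPLIT `p`; at a split `p` one needs
Theorem A without `φ|_{G_p} ≠ 1, ω` (the anomalous / `μ > 0` case: programme rows A1, A10; seat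
`bsd-eis-splitmu`). This file is therefore stated at NON-SPLIT `p` only.

## Contents

* `CongruentMemberData p M fE m` — the level-`m` datum of the construction (a `Λ`-module `N`
  [`= X_ord(g_m/ℚ_∞)` for a lattice `≡ T_pE mod p^m`], an element `L` [`= L_p(g_m)` in the period
  normalisation congruent to `ϖ·L_p^{MTT}(E)`], and for `m ≥ 1`: `M/p^m ≅ N/p^m` [Hida (a)+(b) +
  specialisation], `Fitt_Λ(N) = (L)` [THE OPEN THEOREM: CGS Thm. A for `g_m`, in Fitting form — or
  `char = (L)` + no finite submodule, `CongruentMemberData.ofPrinted`], `(L) + (p^m) = (fE) + (p^m)`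
  [two-variable `p`-adic `L`-function over the family at an Eisenstein point]); `ofPrinted` (from the
  printed shape `char = (L)` + no finite submodule) and `self` (the `m = ∞` datum: the typing is
  exact, its content is the route).
* `HigherWeightCongruencesAt W p` — THE TYPED INPUT K2ᴱ-cyc at the pair: for the cyclotomic data, every
  newform, `ϖ`, dual datum `D` of `Sel_{p^∞}(E/ℚ_∞)`, THE non-split Mazur–Tate–Teitelbaum function `L`
  and every integral lift `fE` of `ϖ·L`: `fE ≠ 0` (Rohrlich) and a `CongruentMemberData` at every level.
  A `Prop`; nothing asserted; NOT in print (Keller–Yin p. 4 names it as the missing step).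
* `mazurMainConjectureAt_of_higherWeightCongruences_of_not_split` — THE TRANSFER (kernel): at an odd
  NON-SPLIT multiplicative prime with `E[p]` reducible, `HigherWeightCongruencesAt W p` and Kato–Wuthrich
  (`thm16_charIdeal_dvd_multiplicative_of_reducible`, PUBLISHED, supplying the integral lift) give
  `X2.MazurMainConjectureAt W p`.
* Consumers by name: `bsdp_of_higherWeightCongruences_of_analyticRank_eq_zero_of_not_split` (X2b ∩
  non-split, rank 0, NO parity hypothesis) and `bsdp_of_cellC_of_not_split_of_higherWeightCongruences_of_schneider`
  (O9 ∩ non-split, rank 1, modulo the Schneider certificate; Disegni 2020 Thm. 4).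

What this is NOT: not a proof of any main conjecture; not a statement at split `p`; not the rank-one
display `X2.RankOneDisplay` (which needs, besides Keller–Yin Thm. 5.0.4, the control theorem with
torsion and the BDP value formula at `p ‖ N` — memo §3); coefficient rings: as in the X11b skeleton the
algebra is run over `Λ = ℤ_p⟦T⟧` (`𝒪 = ℤ_p`); members with larger coefficient rings need the same
algebra over `𝒪⟦T⟧` and the base change of `X11b/CongruenceLimitBaseChange.lean`.

References: Keller–Yin arXiv:2402.12781v2 p. 4 (after Thm. 4), §5 (a)–(e), Lemma 5.0.3, Thm. 5.0.4
[KellerYin2024, PRE]; Castella–Grossi–Skinner, Math. Ann. 393 (2025) Thm. A, proof of Thm. D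
[CastellaGrossiSkinner2025]; Castella–Grossi–Lee–Skinner, Invent. Math. 227 (2022) Thm. 5.3.1, (5.7)
[CastellaEtAl2021]; Skinner, Pacific J. Math. 283 (2016) §3.1 p. 192 [Skinner2016PacificMC]; Castella,
Erratum to CJM 6 (2018), p. 4 [Castella2018Erratum]; Greenberg–Vatsal 2000 §2 [GreenbergVatsal2000];
Wuthrich, Doc. Math. 19 (2014) Thm. 16 [Wuthrich2014]; Rohrlich, Invent. Math. 75 (1984)
[Rohrlich1984]; Disegni, Kyoto J. Math. 60 (2020) Thm. 4 [Disegni2020].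
-/

set_option autoImplicit false

noncomputable section

open scoped Classical MatrixGroups ModularForm

open CongruenceSubgroup WeierstrassCurve Literature.NumberTheory.EllipticCurves
  Literature.NumberTheory.EllipticCurves.ModularForms
  Literature.NumberTheory.EllipticCurves.Rank1Residual
  Literature.NumberTheory.EllipticCurves.Rank1Residual.Typed
  Literature.NumberTheory.EllipticCurves.Wuthrich2014
  Literature.NumberTheory.EllipticCurves.SteinWuthrich2013
  Literature.NumberTheory.EllipticCurves.Disegni2020
  Literature.RingTheory.FittingIdeal Literature.NumberTheory.EllipticCurves.Module
  Summit.BirchSwinnertonDyer.Rank1Residual.X11b.CongruenceLimit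

namespace Summit.BirchSwinnertonDyer.Rank1Residual.X2

/-! ### §1. The level-`m` datum and the typed input -/

/-- **Level-`m` datum of the higher-weight transfer** (Skinner 2016 §3.1 (a)–(c) / Castella erratum
p. 4 (a)–(c) / Keller–Yin §5 (a)–(e), cyclotomic and Eisenstein): over `Λ = ℤ_p⟦T⟧`, for the target
module `M` (`= X(E/ℚ_∞)`) and target element `fE` (`ι(fE) = ϖ·L_p^{MTT}(E)`), a finite `Λ`-module `N`
— in the intended instance the Greenberg–Selmer dual `X_ord(g_m/ℚ_∞)` of the weight-`k_m` good ordinary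
member `g_m` of the Hida family through `f_E`, for its lattice `≡ T_pE (mod p^m)` — and `L ∈ Λ` — its
`p`-adic `L`-function in the congruent period normalisation —, such that for `m ≥ 1`:
`congr`: `M/p^m M ≅ N/p^m N` (Hida theory + specialisation); `fitt`: `Fitt_Λ(N) = (L)` (Mazur's main
conjecture for `g_m` in Fitting form: THE OPEN higher-weight Theorem A of Castella–Grossi–Skinner for a
residually reducible form, `φ|_{G_p} ≠ 1, ω`); `lcongr`: `(L) + (p^m) = (fE) + (p^m)` (two-variable
`p`-adic `L`-function over the family). At `m = 0` the conditions are vacuous. A hypothesis structure;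
nothing asserted. [cite: Skinner2016PacificMC, §3.1 (a)–(c) and p. 192 (shape only; nothing asserted)]
[cite: KellerYin2024, §5 (a)–(e) (shape only; nothing asserted)] -/
structure CongruentMemberData (p : ℕ) [Fact p.Prime] (M : Type) [AddCommGroup M]
    [Module (IwasawaAlgebra p) M] (fE : IwasawaAlgebra p) (m : ℕ) : Type 1 where
  /-- The level-`m` module (`X_ord(g_m/ℚ_∞)`). -/
  N : Type
  /-- `N` is an abelian group. -/
  [addCommGroup : AddCommGroup N]
  /-- `N` is a `Λ`-module. -/
  [module : Module (IwasawaAlgebra p) N]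
  /-- `N` is finitely generated over `Λ`. -/
  [finite : Module.Finite (IwasawaAlgebra p) N]
  /-- The level-`m` element (`L_p(g_m)`). -/
  L : IwasawaAlgebra p
  /-- Congruence of modules: `M/p^m M ≅ N/p^m N`. -/
  congr : 1 ≤ m →
    ((M ⧸ ((Ideal.span {(PowerSeries.C (p : ℤ_[p]) : IwasawaAlgebra p)}) ^ m •
        (⊤ : Submodule (IwasawaAlgebra p) M))) ≃ₗ[IwasawaAlgebra p]
      (N ⧸ ((Ideal.span {(PowerSeries.C (p : ℤ_[p]) : IwasawaAlgebra p)}) ^ m •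
        (⊤ : Submodule (IwasawaAlgebra p) N))))
  /-- The main conjecture at level `m`, Fitting form: `Fitt_Λ(N) = (L)`. -/
  fitt : 1 ≤ m → Module.fittingIdeal (IwasawaAlgebra p) N 0 = Ideal.span {L}
  /-- Congruence of `L`-functions: `(L) + (p^m) = (fE) + (p^m)`. -/
  lcongr : 1 ≤ m →
    Ideal.span {L} ⊔ (Ideal.span {(PowerSeries.C (p : ℤ_[p]) : IwasawaAlgebra p)}) ^ m =
      Ideal.span {fE} ⊔ (Ideal.span {(PowerSeries.C (p : ℤ_[p]) : IwasawaAlgebra p)}) ^ m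

attribute [instance] CongruentMemberData.addCommGroup CongruentMemberData.module
  CongruentMemberData.finite

namespace CongruentMemberData

variable {p : ℕ} [Fact p.Prime] {M : Type} [AddCommGroup M] [Module (IwasawaAlgebra p) M]
  {fE : IwasawaAlgebra p} {m : ℕ}

/-- **The PRINTED form of the level-`m` main conjecture gives the Fitting form**: if `N` is
`Λ`-torsion with `char_Λ(N) = (L)` and has no nonzero submodule of finite length (Castella erratum
Lemma 2.2 / Skinner (e): "`Fitt = Ch`"), then `Fitt_Λ(N) = (L)`
(`X11b.CongruenceLimit.fittingIdeal_zero_eq_span_of_charIdeal_eq_span_of_forall_length`); so a datum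
may be built from the printed shape. In the residually reducible setting finite submodules can occur
(Keller–Yin §5: "the characteristic ideals are no longer identified with the Fitting ideals … replacing
the Selmer groups by their free parts"), which is why the structure asks for the Fitting form.
[cite: Castella2018Erratum, Lemma 2.2 and proof of Thm. 1.1 (p. 4)] [cite: KellerYin2024, §5 (e)] -/
def ofPrinted (N : Type) [AddCommGroup N] [Module (IwasawaAlgebra p) N]
    [Module.Finite (IwasawaAlgebra p) N] (L : IwasawaAlgebra p)
    (congr : 1 ≤ m →
      ((M ⧸ ((Ideal.span {(PowerSeries.C (p : ℤ_[p]) : IwasawaAlgebra p)}) ^ m •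
          (⊤ : Submodule (IwasawaAlgebra p) M))) ≃ₗ[IwasawaAlgebra p]
        (N ⧸ ((Ideal.span {(PowerSeries.C (p : ℤ_[p]) : IwasawaAlgebra p)}) ^ m •
          (⊤ : Submodule (IwasawaAlgebra p) N)))))
    (hT : Module.IsTorsion (IwasawaAlgebra p) N)
    (hCh : charIdeal (IwasawaAlgebra p) N = Ideal.span {L})
    (hnf : ∀ N' : Submodule (IwasawaAlgebra p) N, Module.length (IwasawaAlgebra p) N' ≠ ⊤ → N' = ⊥)
    (lcongr : 1 ≤ m →
      Ideal.span {L} ⊔ (Ideal.span {(PowerSeries.C (p : ℤ_[p]) : IwasawaAlgebra p)}) ^ m =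
        Ideal.span {fE} ⊔ (Ideal.span {(PowerSeries.C (p : ℤ_[p]) : IwasawaAlgebra p)}) ^ m) :
    CongruentMemberData p M fE m where
  N := N
  L := L
  congr := congr
  fitt := fun _ ↦ fittingIdeal_zero_eq_span_of_charIdeal_eq_span_of_forall_length p N hT hnf hCh
  lcongr := lcongr

end CongruentMemberData

/-- **TYPED MISSING INPUT K2ᴱ-cyc at the pair `(E, p)` — "the results in [CGS] extended to higher
weight modular forms" (Keller–Yin p. 4), in the shape the kernel transfer consumes.** For the
cyclotomic `ℤ_p`-extension `κ` with topological generator `γ` matching the cyclotomic variable, every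
newform `f` of `W`, every `ϖ ∈ ℚ` with `ϖ·Ω_E = Ω⁺_f`, every Pontryagin-dual datum `D` of
`Sel_{p^∞}(E/ℚ_∞)`, THE non-split Mazur–Tate–Teitelbaum function `L` (`IsMultPAdicLFunctionOf f p (-1) L`)
and every integral lift `fE ∈ Λ` of `ϖ·L` (`ι(fE) = ϖ·L`; one exists by Kato–Wuthrich at a reducible
multiplicative prime): `fE ≠ 0` (Rohrlich 1984: `L ≠ 0`) and, for every `m`, a `CongruentMemberData p D.X fE m`
— a congruent good-ordinary higher-weight member of the Hida family through `f_E` with ITS main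
conjecture (CGS Theorem A in weight `k_m > 2`, residually reducible, `φ|_{G_p} ≠ 1, ω` — automatic at a
non-split `p`) and the congruence of `p`-adic `L`-functions. NOT IN PRINT (no higher-weight Theorem A
exists; Keller–Yin name it as the missing step); a `Prop`; nothing asserted; every consumer is
CONDITIONAL. [cite: KellerYin2024, p. 4 (remark after Thm. 4) and §5 (a)–(e) (shape only; nothing asserted)]
[cite: Skinner2016PacificMC, §3.1 p. 192 (shape only; nothing asserted)] -/
@[conjecture] def HigherWeightCongruencesAt (W : WeierstrassCurve ℚ) [W.IsElliptic]
    [W.IsGloballyMinimal] (p : ℕ) [Fact p.Prime] : Prop :=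
  ∀ (κ : ZpExtension ℚ p) (γ : Field.absoluteGaloisGroup ℚ),
      κ.IsCyclotomic → κ.IsTopGenerator γ → IsCyclotomicVariable p γ →
    ∀ {N : ℕ} [NeZero N] (f : CuspForm (Gamma0 N) 2), IsNewformOf W f →
    ∀ (D : W.SelmerDualData κ γ) (ϖ : ℚ), (ϖ : ℝ) * W.realPeriodRat = plusPeriod f →
    ∀ (L : PowerSeries ℚ_[p]), IsMultPAdicLFunctionOf f p (-1) L →
    ∀ (fE : IwasawaAlgebra p),
      iwasawaToPowerSeries p fE = PowerSeries.C ((ϖ : ℚ) : ℚ_[p]) * L →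
      fE ≠ 0 ∧ ∀ m : ℕ, Nonempty (CongruentMemberData p D.X fE m)

/-- **Sanity / exactness of the typing (the `m = ∞` datum).** If the Fitting-form main conjecture
ALREADY holds for the target — `Fitt_Λ(M) = (fE)` with `M` finite over `Λ` — then a `CongruentMemberData`
exists at every level, with `N := M`, `L := fE` (identity congruences). So `HigherWeightCongruencesAt`
is implied by (and, by the transfer below, implies the characteristic-ideal form of) Mazur's main
conjecture at the pair: its CONTENT is the route — the freedom to take for `N` the Selmer module of a
GOOD ORDINARY higher-weight member `g_m`, for which the level-`m` identity is a case of the (open)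
higher-weight Theorem A — not a weakening of the conclusion (cf. `X11b/CongruenceLimitSanity.lean`).
[cite: Skinner2016PacificMC, §3.1 (p. 192)] -/
def CongruentMemberData.self {p : ℕ} [Fact p.Prime] {M : Type} [AddCommGroup M]
    [Module (IwasawaAlgebra p) M] [Module.Finite (IwasawaAlgebra p) M] {fE : IwasawaAlgebra p}
    (hF : Module.fittingIdeal (IwasawaAlgebra p) M 0 = Ideal.span {fE}) (m : ℕ) :
    CongruentMemberData p M fE m where
  N := M
  L := fE
  congr := fun _ ↦ LinearEquiv.refl _ _
  fitt := fun _ ↦ hF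
  lcongr := fun _ ↦ rfl

/-! ### §2. The transfer: K2ᴱ-cyc ⟹ Mazur's main conjecture at a non-split Eisenstein `p ‖ N` -/

section Transfer

variable (W : WeierstrassCurve ℚ) [W.IsElliptic] [W.IsGloballyMinimal] (p : ℕ) [Fact p.Prime]

/-- **Kernel of the congruence limit on the cyclotomic side**: for a finite `Λ`-module `M`, `fE ≠ 0`
and a `CongruentMemberData p M fE m` at every level, `M` is `Λ`-torsion and
`Fitt_Λ(M) = char_Λ(M) = (fE)` — the X11b kernel theorem
`CongruenceLimit.iwasawaAlgebra_isTorsion_and_charIdeal_eq_of_congruences` ([Ski16, p. 192]) fed with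
the data. [cite: Skinner2016PacificMC, §3.1 (p. 192)] [cite: Castella2018Erratum, proof of Thm. 1.1 (p. 4)] -/
theorem isTorsion_and_charIdeal_eq_of_congruentMemberData {M : Type} [AddCommGroup M]
    [Module (IwasawaAlgebra p) M] [Module.Finite (IwasawaAlgebra p) M] {fE : IwasawaAlgebra p}
    (hfE : fE ≠ 0) (d : ∀ m : ℕ, CongruentMemberData p M fE m) :
    Module.IsTorsion (IwasawaAlgebra p) M ∧
      Module.fittingIdeal (IwasawaAlgebra p) M 0 = Ideal.span {fE} ∧
      charIdeal (IwasawaAlgebra p) M = Ideal.span {fE} :=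
  iwasawaAlgebra_isTorsion_and_charIdeal_eq_of_congruences p (fun m ↦ (d m).N) hfE
    (fun m ↦ (d m).L) (fun m hm ↦ (d m).congr hm) (fun m hm ↦ (d m).fitt hm)
    (fun m hm ↦ (d m).lcongr hm)

/-- **THE TRANSFER (K2ᴱ-cyc ⟹ X2b's typed input), NON-SPLIT `p`.** For `W/ℚ` globally minimal
elliptic and `p ≠ 2` of NON-SPLIT multiplicative reduction with `E[p]` reducible: the typed
higher-weight input `HigherWeightCongruencesAt W p` together with the PUBLISHED Kato–Wuthrich
divisibility at a reducible multiplicative prime (`hWu`, Wuthrich 2014 Thm. 16 — used only to produce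
the integral lift `fE` of `ϖ·L_p^{MTT}(E)`) gives Mazur's main conjecture at the pair in the tree's
normalisation, `X2.MazurMainConjectureAt W p` (torsion; `char_Λ X(E/ℚ_∞) = (fE)`; `ι(fE·1) = ϖ·L` for
THE non-split Mazur–Tate–Teitelbaum function, unique by `IsMultPAdicLFunctionOf.unique`; the split
clause is vacuous). Printed road: Skinner 2016 §3.1 / Keller–Yin §5, with CGS Theorem A for the
higher-weight members as the open input. CONDITIONAL; nothing asserted about the input.
[cite: Skinner2016PacificMC, §3.1 (p. 192)] [cite: KellerYin2024, p. 4 and §5, Lemma 5.0.3]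
[cite: Wuthrich2014, Thm. 16 (p. 397)] -/
theorem mazurMainConjectureAt_of_higherWeightCongruences_of_not_split
    (hWu : thm16_charIdeal_dvd_multiplicative_of_reducible)
    (hp : p ≠ 2) (hmult : W.HasMultiplicativeReductionAtPrime p)
    (hns : ¬ W.HasSplitMultiplicativeReductionAtPrime p) (hred : ¬ W.HasIrreducibleModPGaloisRep p)
    (hK : HigherWeightCongruencesAt W p) : MazurMainConjectureAt W p := by
  intro κ γ hκ hγ hγ' N _ f hf D ϖ hϖ
  -- THE non-split Mazur–Tate–Teitelbaum function and an integral lift of `ϖ·L` (Kato–Wuthrich)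
  obtain ⟨L, hL⟩ := exists_isMultPAdicLFunctionOf_neg_one_of_nonsplit hf hmult hns
  obtain ⟨fE, -, hfE⟩ := (hWu W p hp hmult hred hκ hγ hγ' hf D ϖ hϖ).2.1 hns L hL
  -- the higher-weight data and the congruence limit
  obtain ⟨hfE0, hd⟩ := hK κ γ hκ hγ hγ' f hf D ϖ hϖ L hL fE hfE
  haveI : Module.Finite (IwasawaAlgebra p) D.X :=
    (WeierstrassCurve.SelmerDualData.module_finite_of_isCyclotomic W κ hκ D) hγ
  obtain ⟨htors, -, hchar⟩ :=
    isTorsion_and_charIdeal_eq_of_congruentMemberData p hfE0 (fun m ↦ Classical.choice (hd m))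
  refine ⟨htors, fE, hchar, fun hsplit ↦ absurd hsplit hns, fun _ L' hL' ↦ ⟨1, ?_⟩⟩
  rw [← hL.unique hL', Units.val_one, mul_one, hfE]

end Transfer

/-! ### §3. Consumers by name -/

section Consumers

variable (W : WeierstrassCurve ℚ) [W.IsElliptic] [W.IsGloballyMinimal] (p : ℕ) [Fact p.Prime]

/-- **X2 ∩ {r_an = 0} ∩ {non-split} (sub-cell X2b's non-split half, NO parity hypothesis): `BSD(E,p)`
from K2ᴱ-cyc and PUBLISHED facts** — the transfer, then the tree's rank-zero glue
`bsdp_of_mazurMainConjectureAt_of_analyticRank_eq_zero` (Stein–Wuthrich Thm. 6.1, §4.2 heights,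
Greenberg–Stevens, GZK, modularity). CONDITIONAL on `HigherWeightCongruencesAt W p`.
[cite: SteinWuthrich2013, Thm. 6.1 (p. 20) and §4.2] [cite: KellerYin2024, p. 4 and §5] -/
theorem bsdp_of_higherWeightCongruences_of_analyticRank_eq_zero_of_not_split
    (hWu : thm16_charIdeal_dvd_multiplicative_of_reducible)
    (hJs : thm61_splitMultiplicative) (hJn : thm61_nonsplitMultiplicative)
    (hHs : exists_isSplitMultCanonical) (hHn : exists_isMultCanonical)
    (hGZK : rank_eq_analyticRank_of_analyticRank_le_one) (hmod : hasEntireLFunction_rat)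
    (hpar : nonempty_modularParametrizationData) (hGS : greenberg_stevens (W := W) (p := p))
    (hX : ClassX2 W p) (hns : ¬ W.HasSplitMultiplicativeReductionAtPrime p) (hr : W.analyticRank = 0)
    (hK : HigherWeightCongruencesAt W p) : BSDp W p :=
  bsdp_of_mazurMainConjectureAt_of_analyticRank_eq_zero hJs hJn hHs hHn hGZK hmod hpar W p hGS hX.1
    hX.2.2 hr (mazurMainConjectureAt_of_higherWeightCongruences_of_not_split W p hWu hX.1 hX.2.2 hns
      hX.2.1 hK)

/-- **O9 ∩ {non-split} (X2c, rank ONE, either parity): `BSD(E,p)` from K2ᴱ-cyc, PUBLISHED facts and the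
pair's SCHNEIDER CERTIFICATE** — the transfer, then cc-typer-6's
`bsdp_of_cellC_of_not_split_of_mazurMainConjectureAt_of_schneider` (Disegni 2020 Thm. 4 leading term,
Stein–Wuthrich Thm. 6.1, Gross–Zagier, GZK). On the GV-parity sub-cell this adds nothing (Mazur's MC is
Greenberg–Vatsal's there); on `CellCNonsplitNotGV` it replaces the per-pair route-G congruence by the
class-level input. CONDITIONAL. [cite: Disegni2020, Thm. 4 (§3.2)] [cite: KellerYin2024, p. 4 and §5] -/
theorem bsdp_of_cellC_of_not_split_of_higherWeightCongruences_of_schneider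
    (hWu : thm16_charIdeal_dvd_multiplicative_of_reducible)
    (hDis : padicBSD_rankOne_nonsplitMult) (hJn : thm61_nonsplitMultiplicative)
    (hHn : exists_isMultCanonical) (hGZ : GrossZagier1986_thm_I_7_3)
    (hGZK : rank_eq_analyticRank_of_analyticRank_le_one) (hpar : nonempty_modularParametrizationData)
    (hc : CellC W p) (hns : ¬ W.HasSplitMultiplicativeReductionAtPrime p)
    (hK : HigherWeightCongruencesAt W p)
    (hSch : ∀ (q : ℚ_[p]) (Dh : PAdicHeightData W p), q ≠ 0 → ‖q‖ < 1 → tateJ q = (W.j : ℚ_[p]) →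
      IsMultCanonical Dh q → SchneiderConjecture Dh) :
    BSDp W p :=
  bsdp_of_cellC_of_not_split_of_mazurMainConjectureAt_of_schneider W p hDis hJn hHn hGZ hGZK hpar hc hns
    (mazurMainConjectureAt_of_higherWeightCongruences_of_not_split W p hWu hc.2.1 hc.2.2.2 hns hc.2.2.1
      hK) hSch

end Consumers

end Summit.BirchSwinnertonDyer.Rank1Residual.X2

end
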